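import Literature.RepresentationTheory.HeisenbergGroup.DoubledDeltaDoublingIdentity
import Literature.RepresentationTheory.HeisenbergGroup.DoubledDeltaCayleyGraph
import Literature.RepresentationTheory.HeisenbergGroup.DoubledDeltaDiagonalInvariance
import Literature.NumberTheory.Automorphic.UnitaryCayleyMomentMap
import Literature.NumberTheory.Automorphic.LocalPiFourierStieltjesGenericVanishing
import Literature.NumberTheory.Automorphic.LocallyConstantFibreVanishing
import HarnessLib

/-!
# Howe's «doubling + density» engine for a unitary group over a quadratic algebra acting through the Weil
# representation: an orthogonal pair of common `E¹`-eigenvectors forces `T_Δ(f₁ ⊠ conj f₂) = 0`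

Topic `RepresentationTheory/HeisenbergGroup`; namespace `Literature.RepresentationTheory.HeisenbergGroup`.  One definition with
body (`glueEnd`) and theorems; no named fact, no record, no `sorry`.

ENGINE (**`false_of_orthogonal_eigen_pair`**).  Data: a non-archimedean local field `F` (`2` invertible), quadratic
coordinates `K = F ⊕ F δ` (`IsQuadraticCoordinates`) with conjugation `σ`, a Gram matrix `T₀ ∈ GL_n(F)` (symmetric) and
`H = T₀ ⊗ 1`, the doubled model `ρ_T`, `T = T₀ ⊕ (−T₀)` on `𝒮(F^{n ⊕ n})` with its Frobenius transform `T_Δ`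
(`DoubledDeltaFrobenius`, `DoubledDeltaInvariantFunctional`), a group `G` acting on `𝒮(Fⁿ)` through a homomorphism
`sG : G → S̃p_ψ(W_{T₀})`, and `f₁, f₂ ∈ 𝒮(Fⁿ)` non-zero with
 (orth)   `∫ conj(ω(g) f₁) · f₂ = 0` for all `g ∈ G`;
 (supply) for every parameter `t` off the zero set of the genericity polynomial, some `g ∈ G` acts on `W_{T₀} = F^n × F^n`
          by the Cayley transform `Res(γ_t)` of the skew-adjoint `c_t` (`UnitaryCayleyMomentMap.cayleyFamily`);
 (centre) for every `λ ∈ K` with `λ σ(λ) = 1`, some `g ∈ G` acts on `W_{T₀}` as `reIm ∘ (λ •) ∘ reIm⁻¹` and on `f₁, f₂` by a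
          common scalar of modulus `1`.
CONCLUSION: `False`.  PROOF: `φ = T_Δ(f₁ ⊠ conj f₂) ≠ 0`;  for generic `t` the local doubling identity
(`integral_gauss_mul_deltaFrobenius_boxSB_eq_zero`, with the Cayley-graph algebra of `DoubledDeltaCayleyGraph`) gives
`∫ ψ(Q(u) · t) φ(u) du = 0` where `Q` is the quadratic moment map (`momentMap_dotProduct`, `alt_polar_reIm_resEnd`,
`deltaGram_glue`); the Fourier–Stieltjes argument (`setIntegral_preimage_vadd_piPrimePowBall_eq_zero_of_forall_eval_ne_zero`)
upgrades this to `∫_{Q⁻¹(a + 𝔭^N)} φ = 0` for all cosets; the fibres of `Q` are `E¹`-orbits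
(`exists_smul_eq_of_momentMap_eq`) along which `φ` is constant (`deltaFrobenius_boxSB_conjSB_apply_glue_symplectic` + (centre));
so `φ = 0` by `eq_zero_of_isLocallyConstant_of_forall_setIntegral_preimage_vadd_eq_zero` — contradiction.

This is [Howe1979, §11]'s proof that the theta lift of an irreducible representation of the COMPACT member of a dual
pair is irreducible, written for [MoeglinVignerasWaldspurger1987, Chap. 3 IV.4 Théorème principal 1) a)] in the rank-one
unitary case (cell `hodgecm-mathlib`, KEY `b4-howe-compact-irreducible`; consumer
`MoeglinVignerasWaldspurger1987/RankOneThetaLiftIrreducibleProofs.lean`).  Nothing else is asserted.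

## References
* [Howe1979] R. Howe, *θ-series and invariant theory*, Proc. Symp. Pure Math. 33.1 (1979), §11.
* [MoeglinVignerasWaldspurger1987] C. Mœglin, M.-F. Vignéras, J.-L. Waldspurger, LNM 1291 (1987), Chap. 3 IV.4.
-/

set_option autoImplicit false

noncomputable section

open _root_.MeasureTheory Set Filter
open scoped ComplexConjugate Matrix Pointwise Topology
open Literature.NumberTheory.Automorphic Literature.NumberTheory.Automorphic.UnitaryGroup
open Literature.NumberTheory.Automorphic.UnitaryGroup.QuadraticCoordinates

namespace Literature.RepresentationTheory.HeisenbergGroup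

/-! ## §1 Block-diagonal reading of an endomorphism of `Fⁿ × Fⁿ` on `F^{n ⊕ n}` -/

section Glue

variable {K : Type*} [CommRing K] {κ ι : Type*} (e : κ ⊕ κ ≃ ι)

/-- an endomorphism `C` of `K^κ × K^κ` read on `K^ι` through `glue`/`resL`/`resR`:
`u ↦ glue (C (u|₁, u|₂))`. [cite: MoeglinVignerasWaldspurger1987, Chap. 2 I.7] -/
def glueEnd (C : ((κ → K) × (κ → K)) →ₗ[K] ((κ → K) × (κ → K))) : (ι → K) →ₗ[K] (ι → K) where
  toFun u := glue e (C (resL e u, resR e u)).1 (C (resL e u, resR e u)).2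
  map_add' u u' := by
    have : (resL e (u + u'), resR e (u + u')) = (resL e u, resR e u) + (resL e u', resR e u') := rfl
    rw [this, map_add, Prod.fst_add, Prod.snd_add, ← glue_add]
  map_smul' a u := by
    have : (resL e (a • u), resR e (a • u)) = a • (resL e u, resR e u) := rfl
    rw [this, map_smul, Prod.smul_fst, Prod.smul_snd, RingHom.id_apply, smul_glue]

/-- formula on glued vectors. [cite: MoeglinVignerasWaldspurger1987, Chap. 2 I.7] -/
@[simp] theorem glueEnd_glue (C : ((κ → K) × (κ → K)) →ₗ[K] ((κ → K) × (κ → K))) (a b : κ → K) :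
    glueEnd e C (glue e a b) = glue e (C (a, b)).1 (C (a, b)).2 := by
  simp [glueEnd]

/-- formula. [cite: MoeglinVignerasWaldspurger1987, Chap. 2 I.7] -/
theorem glueEnd_apply (C : ((κ → K) × (κ → K)) →ₗ[K] ((κ → K) × (κ → K))) (u : ι → K) :
    glueEnd e C u = glue e (C (resL e u, resR e u)).1 (C (resL e u, resR e u)).2 := rfl

end Glue

/-! ## §2 Compact sets lie in a box -/

section Box

variable {F : Type*} [Field F] [ValuativeRel F] [TopologicalSpace F] [IsNonarchimedeanLocalField F]
  {m : Type*} [Fintype m]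

/-- a compact subset of `F^m` lies in some box `(𝔭^{-R})^m` (private copy; the tree's
`SchrodingerFibreCovariance.exists_subset_piPrimePowBall_of_isCompact` landed concurrently). [folklore] -/
private theorem exists_subset_piPrimePowBall_of_isCompact' {S : Set (m → F)} (hS : IsCompact S) :
    ∃ R : ℕ, S ⊆ piPrimePowBall F m (-(R : ℤ)) := by
  obtain ⟨s, hs⟩ := hS.elim_finite_subcover (fun k : ℕ => piPrimePowBall F m (-(k : ℤ)))
    (fun k => isOpen_piPrimePowBall _) fun x _ => by
      obtain ⟨k, hk⟩ := exists_mem_piPrimePowBall x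
      exact Set.mem_iUnion.2 ⟨k, hk⟩
  refine ⟨s.sup id, fun x hx => ?_⟩
  obtain ⟨k, hk⟩ := Set.mem_iUnion.1 (hs hx)
  obtain ⟨hks, hxk⟩ := Set.mem_iUnion.1 hk
  have hle : (k : ℤ) ≤ (s.sup id : ℕ) := by exact_mod_cast Finset.le_sup (f := id) hks
  exact piPrimePowBall_antitone (neg_le_neg hle) hxk

end Box

/-! ## §3 The engine -/

section Engine

variable {F : Type*} [Field F] [ValuativeRel F] [TopologicalSpace F] [IsNonarchimedeanLocalField F] [Invertible (2 : F)]
  [T2Space F] {K : Type*} [Field K] [Algebra F K] [Module.Finite F K] {Ψ : (F × F) ≃+ K} {δ : K} {d : F}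
  (hq : IsQuadraticCoordinates (algebraMap F K) Ψ δ d) {σ : K →+* K}
  (hσφ : ∀ a, σ (algebraMap F K a) = algebraMap F K a) (hσδ : σ δ = -δ) (hσσ : ∀ x, σ (σ x) = x)
  {n : Type*} [Fintype n] [DecidableEq n] {T₀ : Matrix n n F} (hT₀s : T₀.IsSymm) (hT₀d : IsUnit T₀.det)
  {H : Matrix n n K} (hH : H = T₀.map (algebraMap F K))
  {ι : Type*} [Fintype ι] [DecidableEq ι] (e : n ⊕ n ≃ ι) {T : Matrix ι ι F}
  (hT : T = Matrix.reindex e e (Matrix.fromBlocks T₀ 0 0 (-T₀)))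
  {ψ : AddChar F Circle} (hl : IsLocallyConstant (⇑ψ : F → Circle)) (hψ : ψ.IsContinuousNontrivial)
  (hb₀ : ∀ y : n → F, Continuous fun u : n → F => Matrix.toLinearMap₂' F T₀ u y)
  (hb₀' : ∀ y : n → F, Continuous fun u : n → F => Matrix.toLinearMap₂' F (-T₀) u y)
  (hb : ∀ y : ι → F, Continuous fun u : ι → F => Matrix.toLinearMap₂' F T u y)
  (hbΔ : ∀ y : ι → F, Continuous fun u : ι → F => Matrix.toLinearMap₂' F (deltaGram e T₀) u y)
  [MeasurableSpace (n → F)] [BorelSpace (n → F)] (μ : Measure (n → F)) [μ.IsAddHaarMeasure]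
  [MeasurableSpace (ι → F)] [BorelSpace (ι → F)] (ν : Measure (ι → F)) [ν.IsAddHaarMeasure] [SFinite ν]
  {G : Type*} [Group G] (sG : G →* MpPsi (schrodingerSB (Matrix.toLinearMap₂' F T₀) ψ hl hb₀))

omit [ValuativeRel F] [TopologicalSpace F] [IsNonarchimedeanLocalField F] [Module.Finite F K] [T2Space F]
  [MeasurableSpace (n → F)] [MeasurableSpace (ι → F)] in
include hq hσφ hσδ hT₀s hH in
/-- **the phase of the doubling identity is the moment map**: `½ β_Δ(u, b_t u) = Q(v_u) · t` for
`b_t = glueEnd (Res c_t)` and `v_u = reIm⁻¹(u|₁, u|₂)`. [cite: Howe1979, §11] -/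
theorem half_mul_toLinearMap₂'_deltaGram_glueEnd (t : n × n × Fin 2 → F) (u : ι → F) :
    ⅟(2 : F) * Matrix.toLinearMap₂' F (deltaGram e T₀) u (glueEnd e (hq.resEnd n (skewFamily Ψ σ H t)) u) =
      momentMap Ψ σ H ((reIm Ψ n).symm (resL e u, resR e u)) ⬝ᵥ t := by
  rw [momentMap_dotProduct hq hσφ, ← alt_polar_reIm_resEnd hq hσφ hσδ hT₀s hH, AddEquiv.apply_symm_apply]
  conv_lhs => rw [← glue_resL_resR e u]
  rw [glueEnd_glue, deltaGram_glue, alt_apply, polar_apply, polar_apply]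
  have h2 : ⅟(2 : F) * 2 = 1 := invOf_mul_self _
  linear_combination (Matrix.toLinearMap₂' F T₀ (resL e u) ((hq.resEnd n (skewFamily Ψ σ H t)) (resL e u, resR e u)).2 -
    Matrix.toLinearMap₂' F T₀ ((hq.resEnd n (skewFamily Ψ σ H t)) (resL e u, resR e u)).1 (resR e u)) * h2

include hT hq hσφ hσδ hσσ hT₀s hT₀d hH hb₀' hbΔ hψ ν in
set_option maxHeartbeats 1600000 in
/-- **Howe's engine** (see the file header). [cite: Howe1979, §11] -/
theorem false_of_orthogonal_eigen_pair (h2 : (2 : F) ≠ 0) (f₁ f₂ : SchwartzBruhat (n → F)) (hf₁ : f₁ ≠ 0) (hf₂ : f₂ ≠ 0)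
    (horth : ∀ g : G, ∫ u, conj (((MpPsi.toRep _ (sG g) f₁ : SchwartzBruhat (n → F)) : (n → F) → ℂ) u) *
      ((f₂ : SchwartzBruhat (n → F)) : (n → F) → ℂ) u ∂μ = 0)
    (hsupply : ∀ t : n × n × Fin 2 → F, IsUnit (skewFamily Ψ σ H t - 1).det → IsUnit (skewFamily Ψ σ H t + 1).det →
      ∃ g : G, ∀ w, ((MpPsi.proj _ (sG g)).1 : _ ≃ₗ[F] _) w = hq.resEnd n (cayleyFamily Ψ σ H t) w)
    (hcenter : ∀ l : K, l * σ l = 1 → ∃ g : G, ∃ ξ : ℂ, ‖ξ‖ = 1 ∧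
      (∀ y : n → K, ((MpPsi.proj _ (sG g)).1 : _ ≃ₗ[F] _) (reIm Ψ n y) = reIm Ψ n (l • y)) ∧
      MpPsi.toRep _ (sG g) f₁ = ξ • f₁ ∧ MpPsi.toRep _ (sG g) f₂ = ξ • f₂)
    (𝒯 : SchwartzBruhat (ι → F) ≃ₗ[ℂ] SchwartzBruhat (ι → F))
    (h𝒯 : ∀ Φ : SchwartzBruhat (ι → F), ((𝒯 Φ : SchwartzBruhat (ι → F)) : (ι → F) → ℂ) =
      frobeniusToSchrodinger ((schrodingerSB (Matrix.toLinearMap₂' F T) ψ hl hb).comp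
        (deltaHeisenbergEquiv e T₀ hT).symm.toMonoidHom : Representation ℂ _ (SchwartzBruhat (ι → F)))
        (diagIntegral e μ) Φ) : False := by
  -- the test function `φ = T_Δ(f₁ ⊠ conj f₂)` and the moment map `Q`
  set Fbox : SchwartzBruhat (ι → F) := boxSB F e f₁ (conjSB f₂) with hFbox
  set φ : (ι → F) → ℂ := ((𝒯 Fbox : SchwartzBruhat (ι → F)) : (ι → F) → ℂ) with hφ
  have hφmem : φ ∈ SchwartzBruhat (ι → F) := (𝒯 Fbox).2
  set vOf : (ι → F) → (n → K) := fun u => (reIm Ψ n).symm (resL e u, resR e u) with hvOf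
  set Q : (ι → F) → (n × n × Fin 2 → F) := fun u => momentMap Ψ σ H (vOf u) with hQ
  have hreIm_vOf : ∀ u, reIm Ψ n (vOf u) = (resL e u, resR e u) := fun u => AddEquiv.apply_symm_apply _ _
  -- §1 the doubling identity for generic `t`
  have hphase : ∀ (t : n × n × Fin 2 → F) (u : ι → F),
      ⅟(2 : F) * Matrix.toLinearMap₂' F (deltaGram e T₀) u (glueEnd e (hq.resEnd n (skewFamily Ψ σ H t)) u) = Q u ⬝ᵥ t :=
    fun t u => half_mul_toLinearMap₂'_deltaGram_glueEnd hq hσφ hσδ hT₀s hH e t u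
  have hkey : ∀ t : n × n × Fin 2 → F, IsUnit (skewFamily Ψ σ H t - 1).det → IsUnit (skewFamily Ψ σ H t + 1).det →
      ∫ u, ((ψ (Q u ⬝ᵥ t) : Circle) : ℂ) * φ u ∂ν = 0 := by
    intro t hm hp
    obtain ⟨g, hg⟩ := hsupply t hm hp
    set g₁ := MpPsi.proj _ (sG g) with hg₁
    set M₁ : SchwartzBruhat (n → F) ≃ₗ[ℂ] SchwartzBruhat (n → F) := MpPsi.toOp _ (sG g) with hM₁def
    have hM₁ : Implements (schrodingerSB (Matrix.toLinearMap₂' F T₀) ψ hl hb₀) (ofSymplectic _ g₁) M₁ :=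
      MpPsi.toRep_implements _ (sG g)
    set C := hq.resEnd n (skewFamily Ψ σ H t) with hCdef
    have hC : ∀ w, C (g₁.1 w - w) = g₁.1 w + w := fun w => by
      rw [hg w]; exact resEnd_skewFamily_cayley hq t hm w
    have hs : Function.Surjective fun w => g₁.1 w - w := by
      haveI : Invertible (2 : K) := invertibleOfNonzero (by
        rw [show (2 : K) = algebraMap F K 2 from (map_ofNat _ 2).symm]; exact (map_ne_zero _).2 h2)
      have := resEnd_cayleyFamily_sub_surjective hq (σ := σ) (H := H) t hm
      intro x; obtain ⟨w, hw⟩ := this x; exact ⟨w, by simp only [hg w]; exact hw⟩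
    have hgalt : ∀ w w', alt (polar (Matrix.toLinearMap₂' F T₀)) (g₁.1 w) (g₁.1 w') =
        alt (polar (Matrix.toLinearMap₂' F T₀)) w w' := (mem_symplecticGroup _ _).1 g₁.2
    have hsym : ∀ u u' : ι → F, Matrix.toLinearMap₂' F (deltaGram e T₀) u (glueEnd e C u') =
        Matrix.toLinearMap₂' F (deltaGram e T₀) u' (glueEnd e C u) := by
      intro u u'
      conv_lhs => rw [← glue_resL_resR e u]
      conv_rhs => rw [← glue_resL_resR e u']
      rw [glueEnd_apply, glueEnd_apply]
      exact toLinearMap₂'_deltaGram_glue_cayley_symm e T₀ hC hgalt hs (resL e u, resR e u) (resL e u', resR e u')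
    have hgraph : ∀ α β : n → F, ∃ x : ι → F,
        deltaHeisenbergEquiv e T₀ hT ((ofSymplectic _ (spInl e T₀ (-T₀) hT g₁)).act ⟨deltaW e α β, 0⟩) =
          ⟨(x, glueEnd e C x), ⅟(2 : F) * Matrix.toLinearMap₂' F (deltaGram e T₀) x (glueEnd e C x)⟩ := by
      intro α β
      set x : (n → F) × (n → F) := ⅟(2 : F) • (g₁.1 (α, β) - (α, β)) with hx
      have h2x : (2 : F) • x = g₁.1 (α, β) - (α, β) := by rw [hx, smul_smul, mul_invOf_self, one_smul]
      refine ⟨glue e x.1 x.2, ?_⟩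
      rw [deltaHeisenbergEquiv_act_spInl_deltaW e T₀ hT g₁ hC α β x h2x, glueEnd_glue]
    have horth' : ∫ u, conj (((M₁.symm f₁ : SchwartzBruhat (n → F)) : (n → F) → ℂ) u) *
        ((f₂ : SchwartzBruhat (n → F)) : (n → F) → ℂ) u ∂μ = 0 := by
      have := horth g⁻¹
      rwa [map_inv] at this
    have hI := integral_gauss_mul_deltaFrobenius_boxSB_eq_zero e T₀ hT hl hb₀ hb₀' hb hbΔ μ ν hψ hT₀d g₁ M₁ hM₁
      (glueEnd e C) hsym hgraph f₁ f₂ horth' 𝒯 h𝒯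
    rw [hCdef] at hI
    simp only [hphase] at hI
    exact hI
  -- §2 continuity and boundedness of `Q`
  have hQcoord : ∀ (u : ι → F) (k : n × n × Fin 2), Q u k =
      ⅟(2 : F) * Matrix.toLinearMap₂' F (deltaGram e T₀) u (glueEnd e (hq.resEnd n (skewFamily Ψ σ H (Pi.single k 1))) u) := by
    intro u k
    rw [hphase, dotProduct_comm, single_one_dotProduct]
  have hQc : Continuous Q := by
    refine continuous_pi fun k => ?_
    simp only [hQcoord, Matrix.toLinearMap₂'_apply']
    refine continuous_const.mul (continuous_id.dotProduct (continuous_const.matrix_mulVec ?_))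
    have : (⇑(glueEnd e (hq.resEnd n (skewFamily Ψ σ H (Pi.single k 1)))) : (ι → F) → (ι → F)) =
        fun v => LinearMap.toMatrix' (glueEnd e (hq.resEnd n (skewFamily Ψ σ H (Pi.single k 1)))) *ᵥ v := by
      funext v; rw [← Matrix.toLin'_apply, Matrix.toLin'_toMatrix']
    rw [this]; exact continuous_const.matrix_mulVec continuous_id
  have hφcs : HasCompactSupport φ := (mem_schwartzBruhat_iff.1 hφmem).2
  have hφlc : IsLocallyConstant φ := (mem_schwartzBruhat_iff.1 hφmem).1
  obtain ⟨R, hR⟩ := exists_subset_piPrimePowBall_of_isCompact' (hφcs.isCompact.image hQc)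
  have hQbd : ∀ u, φ u ≠ 0 → Q u ∈ piPrimePowBall F (n × n × Fin 2) (-(R : ℤ)) := fun u hu =>
    hR ⟨u, subset_tsupport _ hu, rfl⟩
  -- §3 Fourier–Stieltjes: `∫_{Q⁻¹(a + 𝔭^N)} φ = 0`
  obtain ⟨p, hp0, hp⟩ := exists_mvPolynomial_skewFamily hq hσφ (σ := σ) (H := H) (n := n)
  letI : MeasurableSpace (n × n × Fin 2 → F) := borel _
  haveI : BorelSpace (n × n × Fin 2 → F) := ⟨rfl⟩
  have hvan : ∀ (a : n × n × Fin 2 → F) (N : ℤ), ∫ u in Q ⁻¹' (a +ᵥ piPrimePowBall F (n × n × Fin 2) N), φ u ∂ν = 0 :=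
    fun a N => setIntegral_preimage_vadd_piPrimePowBall_eq_zero_of_forall_eval_ne_zero ν hψ
      (integrable_of_mem_schwartzBruhat ν hφmem) hQc.measurable hQbd hp0
      (fun t ht => hkey t ((hp t).1 ht).1 ((hp t).1 ht).2) a N
  -- §4 the fibres of `Q` are `E¹`-orbits, along which `φ` is constant
  have hfib : ∀ u₀ u : ι → F, Q u = Q u₀ → φ u = φ u₀ := by
    intro u₀ u hQu
    obtain ⟨l, hl1, hlv⟩ := exists_smul_eq_of_momentMap_eq hq hσφ hσδ hσσ hT₀s hT₀d hH h2 (v := vOf u₀) (v' := vOf u)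
      hQu.symm
    obtain ⟨g, ξ, hξ, hgre, h₁, h₂⟩ := hcenter l hl1
    have key := deltaFrobenius_boxSB_conjSB_apply_glue_symplectic e T₀ hT hl hb hb₀ μ hψ hT₀d (MpPsi.proj _ (sG g))
      (M₁ := MpPsi.toOp _ (sG g)) (MpPsi.toRep_implements _ (sG g)) hξ h₁ h₂ hf₁ (resL e u₀) (resR e u₀)
    have hgu : (MpPsi.proj _ (sG g)).1 (resL e u₀, resR e u₀) = (resL e u, resR e u) := by
      rw [← hreIm_vOf u₀, hgre, ← hlv, hreIm_vOf]
    rw [hgu, glue_resL_resR, glue_resL_resR, ← h𝒯] at key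
    exact key
  -- §5 `φ = 0`: contradiction
  have hφ0 : ∀ u₀, φ u₀ = 0 := fun u₀ =>
    eq_zero_of_isLocallyConstant_of_forall_setIntegral_preimage_vadd_eq_zero (μ := ν) hQc hφcs hφlc
      (fun u _ hu => hfib u₀ u hu) (s := fun N : ℕ => piPrimePowBall F (n × n × Fin 2) (N : ℤ))
      (fun N => isOpen_piPrimePowBall _) (fun N => zero_mem_piPrimePowBall _)
      (fun W hW => exists_piPrimePowBall_subset_of_mem_nhds_zero hW) (fun N => hvan (Q u₀) N)
  have hFbox : Fbox = 0 := by
    apply 𝒯.injective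
    rw [map_zero]
    exact Subtype.ext (funext hφ0)
  have hcf₂ : conjSB f₂ ≠ 0 := fun h0 => hf₂ (by rw [← conjSB_conjSB f₂, h0]; exact Subtype.ext (funext fun u => by simp))
  exact boxSB_ne_zero F e hf₁ hcf₂ hFbox

end Engine

end Literature.RepresentationTheory.HeisenbergGroup

end
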